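import Literature.MathematicalPhysics.QuantumFieldTheory.Balaban1983to89.B8Eq155JBound

/-!
# `Balaban1983to89.B8Ineq1141SectG` — [Balaban1985RegularSpaces] Sect. G p. 100: the set-up displays (1.141) and
# (1.142) of Proposition 7 («|(U₁U₀)(∂p) − 1|» and «|D^{η*}_{U₁U₀}∂U₁U₀|» for `U₁ = e^{iηA}`) on the `ℤ^d` carriers
# of the lineage

statement-level skeleton of published theorems with citation tags; proofs where landed; nothing here is a claim about the Yang–Mills mass gap

T. Bałaban, *Spaces of regular gauge field configurations on a lattice and gauge fixing conditions*, Commun.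
Math. Phys. **99** (1985) 75–102 `[Balaban1985RegularSpaces]` ("B8"; printed page = PDF page + 74).
PDF held: `paper:balaban1985-cmp99-regular-spaces-gauge-fixing` (lit store), pp. 77 and 100 read as text
(`p0003.txt`, `p0026.txt`).  STATUS: a published, refereed paper; this file ASSEMBLES two displayed steps of its
Sect. G from the kernel theorems already in the tree (`B8Eq143PlaqExpansion` (1.43), `B8Eq146AExpansion` (1.47),
`B8Eq151V2Divergence` (1.54), `B8Eq155JBound` §5) — nothing here is new mathematics and nothing here is a claim
about the Clay problem.  Companion: `B8Ineq1144ClassAk` (the `𝔄_k`-clause of (1.144) assembled from this file).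

WHAT IS REPRODUCED (lit-balaban SKELETON rows): **B8.Eq1.141-1.143** — the displays (1.141) and (1.142) as named
theorems (the row's cell recorded «no decl literally named (1.141)/(1.142)»; (1.143) is `B8Eq156Prop4.ineq1143`);
they are the two inputs of **B8.Prop7** (1.144).  Unit `lit-balaban-p40` (Phase-2 proof seat p40, gen 4), HOME
`run/shared/lean/pub/lit-balaban/` (SKELETON.md rows B8.Eq1.141-1.143, B8.Prop7; owner fold
`lit-balaban-r05/ROWS-B8.md`).

## THE PRINTED TEXT (p. 100 [PDF 26], quoted from the text layer; p. 77 for (1.7)–(1.9))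

«G. An Inverse Theorem to Theorem 2.  … We assume that we are given a gauge field configuration U₀,
U₀ ∈ 𝔄_k({Ω_j}, α₀), (1.139) and a Lie algebra valued configuration A satisfying
Lʲη|A|, (Lʲη)²|∇^η_{U₀}A|, (Lʲη)³|D^{η*}_{U₀}D^η_{U₀}A| < α₂ on Ω_j. (1.140)
We consider the configuration U₁U₀, U₁ = e^{iηA}. We would like to prove bounds (1.7)–(1.9), i.e. to find spaces
𝔄_k({Ω_j}, α₀′) to which this configuration belongs.  Let us start with estimates of (U₁U₀)(∂p) − 1. The
identity (1.21), the bound (1.47) and the assumptions (1.139), (1.140) imply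
|(U₁U₀)(∂p) − 1| ≦ |U₀(∂p) − 1| + η²|(D^η_{U₀}A)(p)| + ½(η∂|A|(p))² < (α₀ + 2α₂ + 8α₂²)L^{−2j} on Ω_j. (1.141)
The basic estimate (1.54) and the assumptions imply
|D^{η*}_{U₁U₀}∂U₁U₀| < (α₀ + α₂ + 36dα₂² + 50dα₂³ + 10dα₀α₂)(Lʲη)⁻³η². (1.142)
To simplify formulations we assume that α₀, α₂ are so small that α₀ + 2α₂ + 8α₂² ≦ α₀ + 3α₂,
α₀ + α₂ + 36dα₂² + 50dα₂³ + 10dα₀α₂ ≦ α₀ + 2α₂.»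
(p. 77: «|U(∂p) − 1| < α₀L^{−2j} for p ∈ Ω_j (1.7) [⟺ |U(∂p) − 1| < α₀η²(Lʲη)⁻² (1.8)],
|(D^{η*}_U ∂U)(b)| < α₀L^{−2j}(Lʲη)⁻¹ for b ∈ Ω_j (1.9)».)
READING of the third summand of (1.141): the text layer prints debris («+ ½|A|∂|A|(p)|²»-like); by (1.47)
(«a remainder is O₁((1/2!)η²(∂|A|(p))²) = O₁(8α₂²(Lʲη)⁻²η²)», p. 84) it is the second-order Taylor term
`½(η∂|A|(p))²`, whose bound `8α₂²L^{−2j}` is the printed third constant; the theorems below carry the tree's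
certified remainder `½s²(1 + (4/9)s)`, `s = η∂|A|(p)` (`B8Eq146AExpansion.eq147_ord1_printed`) in its place.

## WHAT IS CERTIFIED HERE (kernel; axioms `propext` / `Classical.choice` / `Quot.sound`)

On the `ℤ^d` carriers of the lineage (`B7Prop1Explicit`: sites `Fin d → ℤ`, bond fields `Site d → Fin d → 𝔸ˣ` over
a complete normed `ℂ`-algebra `𝔸` with `‖1‖ = 1`, so `M_N(ℂ)`; gauge group abstracted to
`U1 𝔸 = {|u| ≤ 1, |u⁻¹| ≤ 1} ⊇ U(N)`), with `U(∂p) = B8Ineq132.plaqF`, `D^{η*}_U∂U = B8Ineq132.covDiv` (1.2),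
`U₁U₀ = B8Lemma1NonAbelian.mulCfg U₁ U₀` (1.21), `U₁ = e^{iηA} = B8Eq146AExpansion.expCfg (iEta η A)` (1.41),
`(D^η_{U₀}A)(p) = B8Eq146AExpansion.plaqCovDeriv` ((3.4) of [B9]), `∇^η_{U₀}A = B8Ineq132.covDerivFwd` on the
components of `A`, `D^{η*}_{U₀}D^η_{U₀}A = B8Eq143PlaqExpansion.pdiv η U₀ (plaqCovDeriv η U₀ A)`:
* §0 the units: `η²(Lʲη)⁻² = L^{−2j}` ((1.8) ⟺ (1.7)), `η²(Lʲη)⁻³ = L^{−2j}(Lʲη)⁻¹`, `(Lʲη)⁻¹η = L^{−j} ≤ 1`.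
* §1 **(1.141)**: `ineq1141_pointwise` — at one plaquette `p = p_{μν}(x)`,
  `|(U₁U₀)(∂p) − 1| ≤ (1 + 4u)|U₀(∂p) − 1| + η²|(D^η_{U₀}A)(p)| + ½s²(1 + (4/9)s)`, `s = η∂|A|(p) ≤ 1`, for
  `U1`-valued `U₀, U₁` with `|U₁ − 1| ≤ u` (the identity (1.43) = (1.21) expanded, `B8Eq143PlaqExpansion.eq143`, its
  cross terms `|rem43| ≤ 4u|U₀(∂p) − 1|` kept EXPLICIT where print drops them, and (1.47) at first order); `ineq1141`
  — in print's letters at level `j` (`|A| ≤ α₂(Lʲη)⁻¹`, `|∇^η_{U₀}A| ≤ α₂(Lʲη)⁻²`, `|U₁ − 1| ≤ α₂(Lʲη)⁻¹η`):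
  `≤ (1 + 4α₂L^{−j})|U₀(∂p) − 1| + (2α₂ + 8α₂²(1 + (16/9)α₂L^{−j}))η²(Lʲη)⁻²`; `ineq1141_printed` — with
  `|U₀(∂p) − 1| ≤ α₀η²(Lʲη)⁻²`: `≤ (α₀ + 2α₂ + 8α₂²)L^{−2j} + (4α₀α₂ + (128/9)α₂³)L^{−j}·L^{−2j}` (print's three
  constants `1, 2, 8` with the dropped cross terms explicit).
* §2 **(1.142)**: `ineq1142_pointwise` — at one bond, `|D^{η*}_{U₁U₀}∂(U₁U₀)(b)| ≤ |D^{η*}_{U₀}∂U₀(b)| +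
  η²|D^{η*}_{U₀}D^η_{U₀}A(b)| + 36dα₂(Lʲη)⁻¹Gη² + 50dα₂³(Lʲη)⁻³η² + 10dα₀α₂(Lʲη)⁻³η²` (= (1.54)
  `B8Eq151V2Divergence.eq154_printed` + the triangle inequality; `|∇^η_{U₀}A| ≤ G`); `ineq1142` — with the three
  members of (1.140) and `|D^{η*}_{U₀}∂U₀(b)| ≤ α₀η²(Lʲη)⁻³`:
  `≤ (α₀ + α₂ + 36dα₂² + 50dα₂³ + 10dα₀α₂)(Lʲη)⁻³η²` — THE PRINTED (1.142).
* §3 the HERMITIAN case (`𝔸` a C⋆-algebra, `A(b)` self-adjoint = print's «Lie algebra valued»): the two standing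
  hypotheses on `U₁ = e^{iηA}` of §§1–2 (`U₁ ∈ U1`, `|U₁ − 1| ≤ α₂(Lʲη)⁻¹η`) DISCHARGED by
  `B8Eq155JBound.expCfg_iEta_mem_U1` / `norm_expCfg_iEta_sub_one_le_of_141`: `ineq1141_hermitian`,
  `ineq1142_hermitian`.
The simplification sentence («≦ α₀ + 3α₂», «≦ α₀ + 2α₂») and the `𝔄_k`-membership (1.144) are in the companion
`B8Ineq1144ClassAk`.

## DICTIONARY / HONEST SCOPE — what is NOT claimed

(i) GLOBAL READING.  The parents' (1.43)–(1.55) certificates take their smallness hypotheses on ALL bonds /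
plaquettes of `ℤ^d` at one level `j` (`B8Eq143PlaqExpansion` HONEST SCOPE (ii)); accordingly (1.139)/(1.140) enter
at ONE level: in `ineq1142*` on the whole lattice (`|U₀(∂p) − 1| ≤ α₀L^{−2j}` everywhere, `|A| ≤ α₂(Lʲη)⁻¹`,
`|∇^η_{U₀}A| ≤ α₂(Lʲη)⁻²` everywhere, the bond quantities at the bond), in `ineq1141*` the plaquette quantity at
the plaquette and `|A|`, `|∇^η_{U₀}A|`, `|U₁ − 1|` everywhere.  The localisation of (1.139)/(1.140) to a general
admissible family (1.3)/(1.4) — level by level «on Ω_j» only — is NOT reproduced (it would need local versions of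
the parents' (1.54)).
(ii) `|U₁ − 1| ≤ α₂(Lʲη)⁻¹η` is print's bookkeeping of (1.41) (the factor `e^{ηα₂(Lʲη)⁻¹}` dropped, as everywhere
in B8 Sect. C); it is an explicit hypothesis in §§1–2 and is DERIVED in §3 for Hermitian `A` (`|e^{iηA} − 1| ≤ η|A|`).
(iii) Print's strict `<` in (1.141)/(1.142) presuppose the strict (1.139)/(1.140); the displays are certified as
`≤` from `≤`-hypotheses (the strict forms needed for (1.7)/(1.9) are in the companion); the smallness side
conditions `4α₂(Lʲη)⁻¹η ≤ 1` resp. `16α₂(Lʲη)⁻¹η ≤ 1 ∧ 5α₂(Lʲη)⁻¹η(d − 1) ≤ 4` are the parents'.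
(iv) `T_η` ↦ `ℤ^d` with the spacing carried by the explicit `η > 0`; plaquettes `p_{μν}(x)` for all `μ ≠ ν`.
-/

noncomputable section

open scoped BigOperators
open NormedSpace Finset

namespace Literature.MathematicalPhysics.QuantumFieldTheory.Balaban1983to89.B8Ineq1141SectG

open B7Prop1Explicit
open B8Lemma1NonAbelian (mulCfg)
open B8Ineq132 (plaqF covDeriv covDerivFwd covDiv threshold_18)
open B8Eq143PlaqExpansion (covPlaq covPlaqF rem43 eq143 norm_rem43_le pdiv)
open B8Eq146AExpansion (expCfg iEta plaqCovDeriv plaqCovDeriv_eq_covDerivFwd eq147_ord1_printed norm_iEta_le)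
open B8Eq151V2Divergence (eq154_printed)
open B8Eq155JBound (norm_I_eta_sq_smul)

-- `Site` alone would resolve to the torus sites of `Setup.lean`; re-export the `ℤ^d` sites of `B7Prop1Explicit`.
export B7Prop1Explicit (Site)

variable {d : ℕ}

/-! ## §0. Units -/

section Arith

/-- The units of (1.7)/(1.8): `L^{−j} = (Lʲη)⁻¹·η ≤ 1` for `L ≥ 1`, `η > 0` (so the (1.8) threshold `α₀η²(Lʲη)⁻²`
never exceeds `α₀`). [cite: Balaban1985RegularSpaces, (1.8) p.77] -/
theorem inv_mul_eta_le_one {L : ℕ} (hL : 1 ≤ L) {η : ℝ} (hη : 0 < η) (j : ℕ) :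
    ((L : ℝ) ^ j * η)⁻¹ * η ≤ 1 := by
  have hL1 : (1 : ℝ) ≤ (L : ℝ) ^ j := one_le_pow₀ (by exact_mod_cast hL)
  rw [mul_inv, mul_assoc, inv_mul_cancel₀ hη.ne', mul_one]
  exact inv_le_one_of_one_le₀ hL1

/-- The units of (1.7): `η²((Lʲη)⁻¹)² = (L^j)⁻²`. [cite: Balaban1985RegularSpaces, (1.8) p.77] -/
theorem eta_sq_mul_inv_sq {L : ℕ} {η : ℝ} (hη : η ≠ 0) (j : ℕ) :
    η ^ 2 * (((L : ℝ) ^ j * η)⁻¹) ^ 2 = (((L : ℝ) ^ j)⁻¹) ^ 2 := by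
  have h := threshold_18 L 1 hη j
  simpa only [one_mul] using h

/-- The units of (1.9): `η²((Lʲη)⁻¹)³ = (L^j)⁻²(Lʲη)⁻¹`. [cite: Balaban1985RegularSpaces, (1.9) p.77] -/
theorem eta_sq_mul_inv_cube {L : ℕ} {η : ℝ} (hη : η ≠ 0) (j : ℕ) :
    η ^ 2 * (((L : ℝ) ^ j * η)⁻¹) ^ 3 = (((L : ℝ) ^ j)⁻¹) ^ 2 * ((L : ℝ) ^ j * η)⁻¹ := by
  have h3 : (((L : ℝ) ^ j * η)⁻¹) ^ 3 = (((L : ℝ) ^ j * η)⁻¹) ^ 2 * ((L : ℝ) ^ j * η)⁻¹ := pow_succ _ 2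
  rw [h3, ← mul_assoc, eta_sq_mul_inv_sq hη j]

end Arith

/-! ## §1. (1.141): `|(U₁U₀)(∂p) − 1|` -/

section Plaquette

variable {𝔸 : Type*} [NormedRing 𝔸] [NormOneClass 𝔸] [NormedAlgebra ℂ 𝔸] [CompleteSpace 𝔸]

/-- **(1.141), pointwise sharp form** at one plaquette `p = p_{μν}(x)`: for `U1`-valued `U₀` and `U₁ = e^{iηA}`
`U1`-valued with `|U₁ − 1| ≤ u` on the bonds, `η > 0`, `s := η(|A(x,y)| + |A(y,z)| + |A(z,w)| + |A(w,x)|) ≤ 1`: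
`|(U₁U₀)(∂p) − 1| ≤ (1 + 4u)|U₀(∂p) − 1| + η²|(D^η_{U₀}A)(p)| + ½s²(1 + (4/9)s)` — «the identity (1.21), the bound
(1.47)»: (1.43) `(U₁U₀)(∂p) − 1 = rem43 + [U₀(∂p) − 1] + [(∂_{U₀}U₁)(p) − 1]` with `|rem43| ≤ 4u|U₀(∂p) − 1|`
(the cross terms print drops) and (1.47) at first order. [cite: Balaban1985RegularSpaces, (1.141) p.100] -/
theorem ineq1141_pointwise {η : ℝ} (hη : 0 < η) {U₀ : Site d → Fin d → 𝔸ˣ} (h₀ : ∀ y κ, U₀ y κ ∈ U1 𝔸)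
    (A : Site d → Fin d → 𝔸) (h₁ : ∀ y κ, expCfg (iEta η A) y κ ∈ U1 𝔸) {u : ℝ}
    (hu : ∀ y κ, ‖(expCfg (iEta η A) y κ : 𝔸) - 1‖ ≤ u) (μ ν : Fin d) (x : Site d)
    (hs : η * (‖A x μ‖ + ‖A (x + e μ) ν‖ + ‖A (x + e ν) μ‖ + ‖A x ν‖) ≤ 1) :
    ‖plaqF (mulCfg (expCfg (iEta η A)) U₀) μ ν x - 1‖ ≤
      (1 + 4 * u) * ‖plaqF U₀ μ ν x - 1‖ + η ^ 2 * ‖plaqCovDeriv η U₀ A μ ν x‖ +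
        (η * (‖A x μ‖ + ‖A (x + e μ) ν‖ + ‖A (x + e ν) μ‖ + ‖A x ν‖)) ^ 2 / 2 *
          (1 + 4 / 9 * (η * (‖A x μ‖ + ‖A (x + e μ) ν‖ + ‖A (x + e ν) μ‖ + ‖A x ν‖))) := by
  set U₁ := expCfg (iEta η A) with hU₁
  set s := η * (‖A x μ‖ + ‖A (x + e μ) ν‖ + ‖A (x + e ν) μ‖ + ‖A x ν‖)
  set P := plaqF U₀ μ ν x - 1
  set D := ((Complex.I : ℂ) * η ^ 2) • plaqCovDeriv η U₀ A μ ν x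
  set C := ((covPlaq U₀ U₁ μ ν x : 𝔸ˣ) : 𝔸) - 1
  have hrem : ‖rem43 U₀ U₁ μ ν x‖ ≤ 4 * u * ‖P‖ := norm_rem43_le h₀ h₁ hu le_rfl
  have hcov : ‖C - D‖ ≤ s ^ 2 / 2 * (1 + 4 / 9 * s) := eq147_ord1_printed hη h₀ A μ ν x hs
  have hD : ‖D‖ = η ^ 2 * ‖plaqCovDeriv η U₀ A μ ν x‖ := norm_I_eta_sq_smul η _
  have h143 : plaqF (mulCfg U₁ U₀) μ ν x - 1 = rem43 U₀ U₁ μ ν x + P + C := eq143 U₀ U₁ μ ν x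
  have hC : ‖C‖ ≤ ‖C - D‖ + ‖D‖ := by
    calc ‖C‖ = ‖C - D + D‖ := by rw [sub_add_cancel]
      _ ≤ ‖C - D‖ + ‖D‖ := norm_add_le _ _
  calc ‖plaqF (mulCfg U₁ U₀) μ ν x - 1‖ = ‖rem43 U₀ U₁ μ ν x + P + C‖ := by rw [h143]
    _ ≤ ‖rem43 U₀ U₁ μ ν x‖ + ‖P‖ + ‖C‖ := norm_add₃_le
    _ ≤ 4 * u * ‖P‖ + ‖P‖ + (s ^ 2 / 2 * (1 + 4 / 9 * s) + η ^ 2 * ‖plaqCovDeriv η U₀ A μ ν x‖) := by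
        rw [← hD]; linarith
    _ = (1 + 4 * u) * ‖P‖ + η ^ 2 * ‖plaqCovDeriv η U₀ A μ ν x‖ + s ^ 2 / 2 * (1 + 4 / 9 * s) := by ring

omit [NormOneClass 𝔸] [CompleteSpace 𝔸] in
/-- `η²|(D^η_{U₀}A)(p)| ≤ 2α₂η²(Lʲη)⁻²` from `(D^η_{U₀}A)(p_{μν}(x)) = (D^η_{U₀,μ}A_ν)(x) − (D^η_{U₀,ν}A_μ)(x)` and the
second member of (1.140) `|∇^η_{U₀}A| ≤ α₂(Lʲη)⁻²` — the printed constant `2` of (1.141).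
[cite: Balaban1985RegularSpaces, (1.141) p.100 (second summand)] -/
theorem norm_plaqCovDeriv_le {η : ℝ} (U₀ : Site d → Fin d → 𝔸ˣ) {A : Site d → Fin d → 𝔸} {G : ℝ}
    (hG : ∀ (y : Site d) (κ τ : Fin d), ‖covDerivFwd η U₀ κ (fun z => A z τ) y‖ ≤ G) (μ ν : Fin d)
    (x : Site d) : ‖plaqCovDeriv η U₀ A μ ν x‖ ≤ 2 * G := by
  rw [plaqCovDeriv_eq_covDerivFwd]
  exact (norm_sub_le _ _).trans (by linarith [hG x μ ν, hG x ν μ])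

/-- **(1.141) IN PRINT'S LETTERS at level `j`**: for `U1`-valued `U₀`, `U₁ = e^{iηA}` `U1`-valued with
`|U₁ − 1| ≤ α₂(Lʲη)⁻¹η`, `|A| ≤ α₂(Lʲη)⁻¹` and `|∇^η_{U₀}A| ≤ α₂(Lʲη)⁻²` on all bonds ((1.140), first two members),
`α₂ ≥ 0`, `η > 0`, `4α₂(Lʲη)⁻¹η ≤ 1`, at every plaquette:
`|(U₁U₀)(∂p) − 1| ≤ (1 + 4α₂(Lʲη)⁻¹η)|U₀(∂p) − 1| + (2α₂ + 8α₂²(1 + (16/9)α₂(Lʲη)⁻¹η))·η²(Lʲη)⁻²` — print's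
`η²|(D^η_{U₀}A)(p)| < 2α₂L^{−2j}` and `½(η∂|A|(p))² < 8α₂²L^{−2j}` with the dropped factors explicit.
[cite: Balaban1985RegularSpaces, (1.141) p.100] -/
theorem ineq1141 {η : ℝ} (hη : 0 < η) {U₀ : Site d → Fin d → 𝔸ˣ} (h₀ : ∀ y κ, U₀ y κ ∈ U1 𝔸)
    {A : Site d → Fin d → 𝔸} (h₁ : ∀ y κ, expCfg (iEta η A) y κ ∈ U1 𝔸) {L j : ℕ} {α₂ : ℝ} (hα₂ : 0 ≤ α₂)
    (hu : ∀ y κ, ‖(expCfg (iEta η A) y κ : 𝔸) - 1‖ ≤ α₂ * ((L : ℝ) ^ j * η)⁻¹ * η)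
    (hA : ∀ y κ, ‖A y κ‖ ≤ α₂ * ((L : ℝ) ^ j * η)⁻¹)
    (hG : ∀ (y : Site d) (κ τ : Fin d), ‖covDerivFwd η U₀ κ (fun z => A z τ) y‖ ≤ α₂ * (((L : ℝ) ^ j * η)⁻¹) ^ 2)
    (hsmall : 4 * (α₂ * ((L : ℝ) ^ j * η)⁻¹ * η) ≤ 1) (μ ν : Fin d) (x : Site d) :
    ‖plaqF (mulCfg (expCfg (iEta η A)) U₀) μ ν x - 1‖ ≤
      (1 + 4 * (α₂ * ((L : ℝ) ^ j * η)⁻¹ * η)) * ‖plaqF U₀ μ ν x - 1‖ +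
        (2 * α₂ + 8 * α₂ ^ 2 * (1 + 16 / 9 * (α₂ * ((L : ℝ) ^ j * η)⁻¹ * η))) *
          (η ^ 2 * (((L : ℝ) ^ j * η)⁻¹) ^ 2) := by
  set r : ℝ := ((L : ℝ) ^ j * η)⁻¹ with hr_def
  have hr : 0 ≤ r := inv_nonneg.mpr (by positivity)
  set a : ℝ := α₂ * r * η
  have ha : 0 ≤ a := by positivity
  set s := η * (‖A x μ‖ + ‖A (x + e μ) ν‖ + ‖A (x + e ν) μ‖ + ‖A x ν‖)
  have hs0 : 0 ≤ s := by positivity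
  have hs4 : s ≤ 4 * a := by
    have h1 := hA x μ; have h2 := hA (x + e μ) ν; have h3 := hA (x + e ν) μ; have h4 := hA x ν
    have : ‖A x μ‖ + ‖A (x + e μ) ν‖ + ‖A (x + e ν) μ‖ + ‖A x ν‖ ≤ 4 * (α₂ * r) := by linarith
    calc s ≤ η * (4 * (α₂ * r)) := mul_le_mul_of_nonneg_left this hη.le
      _ = 4 * a := by ring
  have hs1 : s ≤ 1 := hs4.trans hsmall
  have hpt := ineq1141_pointwise hη h₀ A h₁ hu μ ν x hs1
  have hD : η ^ 2 * ‖plaqCovDeriv η U₀ A μ ν x‖ ≤ 2 * α₂ * (η ^ 2 * r ^ 2) := by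
    have := norm_plaqCovDeriv_le U₀ hG μ ν x
    nlinarith [sq_nonneg η]
  have hS : s ^ 2 / 2 * (1 + 4 / 9 * s) ≤ 8 * α₂ ^ 2 * (1 + 16 / 9 * a) * (η ^ 2 * r ^ 2) := by
    have h1 : s ^ 2 / 2 * (1 + 4 / 9 * s) ≤ (4 * a) ^ 2 / 2 * (1 + 4 / 9 * (4 * a)) := by gcongr
    refine h1.trans_eq ?_
    simp only [a]; ring
  calc ‖plaqF (mulCfg (expCfg (iEta η A)) U₀) μ ν x - 1‖
      ≤ (1 + 4 * a) * ‖plaqF U₀ μ ν x - 1‖ + η ^ 2 * ‖plaqCovDeriv η U₀ A μ ν x‖ +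
          s ^ 2 / 2 * (1 + 4 / 9 * s) := hpt
    _ ≤ (1 + 4 * a) * ‖plaqF U₀ μ ν x - 1‖ + 2 * α₂ * (η ^ 2 * r ^ 2) +
          8 * α₂ ^ 2 * (1 + 16 / 9 * a) * (η ^ 2 * r ^ 2) := by linarith
    _ = (1 + 4 * a) * ‖plaqF U₀ μ ν x - 1‖ + (2 * α₂ + 8 * α₂ ^ 2 * (1 + 16 / 9 * a)) * (η ^ 2 * r ^ 2) := by
        ring

/-- **(1.141) WITH THE PRINTED CONSTANTS `1, 2, 8`**: adding (1.139) at level `j` in the form (1.8),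
`|U₀(∂p) − 1| ≤ α₀η²(Lʲη)⁻²`, to the hypotheses of `ineq1141`:
`|(U₁U₀)(∂p) − 1| ≤ (α₀ + 2α₂ + 8α₂²)η²(Lʲη)⁻² + (4α₀α₂ + (128/9)α₂³)·((Lʲη)⁻¹η)·η²(Lʲη)⁻²` — the printed
`(α₀ + 2α₂ + 8α₂²)L^{−2j}` plus the cross terms of order `L^{−j}` that print absorbs into «α₀, α₂ so small».
[cite: Balaban1985RegularSpaces, (1.141) p.100] -/
theorem ineq1141_printed {η : ℝ} (hη : 0 < η) {U₀ : Site d → Fin d → 𝔸ˣ} (h₀ : ∀ y κ, U₀ y κ ∈ U1 𝔸)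
    {A : Site d → Fin d → 𝔸} (h₁ : ∀ y κ, expCfg (iEta η A) y κ ∈ U1 𝔸) {L j : ℕ} {α₀ α₂ : ℝ}
    (hα₂ : 0 ≤ α₂)
    (hu : ∀ y κ, ‖(expCfg (iEta η A) y κ : 𝔸) - 1‖ ≤ α₂ * ((L : ℝ) ^ j * η)⁻¹ * η)
    (hA : ∀ y κ, ‖A y κ‖ ≤ α₂ * ((L : ℝ) ^ j * η)⁻¹)
    (hG : ∀ (y : Site d) (κ τ : Fin d), ‖covDerivFwd η U₀ κ (fun z => A z τ) y‖ ≤ α₂ * (((L : ℝ) ^ j * η)⁻¹) ^ 2)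
    (hsmall : 4 * (α₂ * ((L : ℝ) ^ j * η)⁻¹ * η) ≤ 1) {μ ν : Fin d} {x : Site d}
    (hp : ‖plaqF U₀ μ ν x - 1‖ ≤ α₀ * (η ^ 2 * (((L : ℝ) ^ j * η)⁻¹) ^ 2)) :
    ‖plaqF (mulCfg (expCfg (iEta η A)) U₀) μ ν x - 1‖ ≤
      (α₀ + 2 * α₂ + 8 * α₂ ^ 2) * (η ^ 2 * (((L : ℝ) ^ j * η)⁻¹) ^ 2) +
        (4 * α₀ * α₂ + 128 / 9 * α₂ ^ 3) * (((L : ℝ) ^ j * η)⁻¹ * η) *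
          (η ^ 2 * (((L : ℝ) ^ j * η)⁻¹) ^ 2) := by
  set r : ℝ := ((L : ℝ) ^ j * η)⁻¹
  have hr : 0 ≤ r := inv_nonneg.mpr (by positivity)
  have h := ineq1141 hη h₀ h₁ hα₂ hu hA hG hsmall μ ν x
  have ha : 0 ≤ α₂ * r * η := by positivity
  have h1 : (1 + 4 * (α₂ * r * η)) * ‖plaqF U₀ μ ν x - 1‖ ≤ (1 + 4 * (α₂ * r * η)) * (α₀ * (η ^ 2 * r ^ 2)) :=
    mul_le_mul_of_nonneg_left hp (by positivity)
  refine (h.trans (add_le_add h1 le_rfl)).trans_eq ?_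
  ring

end Plaquette

/-! ## §2. (1.142): `|D^{η*}_{U₁U₀}∂(U₁U₀)|` -/

section Bond

variable {𝔸 : Type*} [NormedRing 𝔸] [NormOneClass 𝔸] [NormedAlgebra ℂ 𝔸] [CompleteSpace 𝔸]

/-- **(1.142), pointwise form** at one bond `b = ⟨x, x + ηe_μ⟩`: «the basic estimate (1.54)»
(`B8Eq151V2Divergence.eq154_printed`, hypotheses as there: `U1`-valued `U₀`, `U₁ = e^{iηA}` `U1`-valued with
`|U₁ − 1| ≤ α₂(Lʲη)⁻¹η`, `|A| ≤ α₂(Lʲη)⁻¹`, `|∇^η_{U₀}A| ≤ G`, `|U₀(∂p) − 1| ≤ α₀η²(Lʲη)⁻²` everywhere,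
`16α₂(Lʲη)⁻¹η ≤ 1`, `5α₂(Lʲη)⁻¹η(d − 1) ≤ 4`) and the triangle inequality:
`|D^{η*}_{U₁U₀}∂(U₁U₀)(b)| ≤ |D^{η*}_{U₀}∂U₀(b)| + η²|(D^{η*}_{U₀}D^η_{U₀}A)(b)| + 36dα₂(Lʲη)⁻¹Gη² +
50dα₂³(Lʲη)⁻³η² + 10dα₀α₂(Lʲη)⁻³η²`. [cite: Balaban1985RegularSpaces, (1.142) p.100] -/
theorem ineq1142_pointwise {η : ℝ} (hη : 0 < η) {U₀ : Site d → Fin d → 𝔸ˣ} (h₀ : ∀ y κ, U₀ y κ ∈ U1 𝔸)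
    {A : Site d → Fin d → 𝔸} (h₁ : ∀ y κ, expCfg (iEta η A) y κ ∈ U1 𝔸) {L j : ℕ} {α₀ α₂ G : ℝ}
    (hα₀ : 0 ≤ α₀) (hα₂ : 0 ≤ α₂) (hA : ∀ y κ, ‖A y κ‖ ≤ α₂ * ((L : ℝ) ^ j * η)⁻¹)
    (hG : ∀ (y : Site d) (κ τ : Fin d), ‖covDerivFwd η U₀ κ (fun z => A z τ) y‖ ≤ G)
    (hu : ∀ y κ, ‖(expCfg (iEta η A) y κ : 𝔸) - 1‖ ≤ α₂ * ((L : ℝ) ^ j * η)⁻¹ * η)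
    (hp : ∀ (y : Site d) (κ ν : Fin d), κ ≠ ν → ‖plaqF U₀ κ ν y - 1‖ ≤ α₀ * η ^ 2 * (((L : ℝ) ^ j * η)⁻¹) ^ 2)
    (hsmall : 16 * (α₂ * ((L : ℝ) ^ j * η)⁻¹ * η) ≤ 1)
    (hd : 5 * (α₂ * ((L : ℝ) ^ j * η)⁻¹ * η) * ((d : ℝ) - 1) ≤ 4) (μ : Fin d) (x : Site d) :
    ‖covDiv η (mulCfg (expCfg (iEta η A)) U₀) μ x‖ ≤
      ‖covDiv η U₀ μ x‖ + η ^ 2 * ‖pdiv η U₀ (plaqCovDeriv η U₀ A) μ x‖ +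
        (36 * d * (α₂ * ((L : ℝ) ^ j * η)⁻¹) * G * η ^ 2 + 50 * d * α₂ ^ 3 * (((L : ℝ) ^ j * η)⁻¹) ^ 3 * η ^ 2 +
          10 * d * α₀ * α₂ * (((L : ℝ) ^ j * η)⁻¹) ^ 3 * η ^ 2) := by
  have h := eq154_printed hη h₀ h₁ hα₀ hα₂ hA hG hu hp hsmall hd μ x
  set T0 := covDiv η (mulCfg (expCfg (iEta η A)) U₀) μ x
  set T1 := covDiv η U₀ μ x
  set P := ((Complex.I : ℂ) * η ^ 2) • pdiv η U₀ (plaqCovDeriv η U₀ A) μ x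
  have hP : ‖P‖ = η ^ 2 * ‖pdiv η U₀ (plaqCovDeriv η U₀ A) μ x‖ := norm_I_eta_sq_smul η _
  have e : T0 = T1 + P + (T0 - T1 - P) := by abel
  calc ‖T0‖ = ‖T1 + P + (T0 - T1 - P)‖ := by rw [← e]
    _ ≤ ‖T1‖ + ‖P‖ + ‖T0 - T1 - P‖ := norm_add₃_le
    _ ≤ _ := by rw [hP]; linarith

/-- **(1.142) WITH THE PRINTED CONSTANTS `1, 1, 36d, 50d, 10d`** at level `j`: with all three members of (1.140)
(`|A| ≤ α₂(Lʲη)⁻¹`, `|∇^η_{U₀}A| ≤ α₂(Lʲη)⁻²`, `|D^{η*}_{U₀}D^η_{U₀}A| ≤ α₂(Lʲη)⁻³`) and (1.139) at level `j`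
(`|U₀(∂p) − 1| ≤ α₀η²(Lʲη)⁻²` on the plaquettes, `|D^{η*}_{U₀}∂U₀(b)| ≤ α₀η²(Lʲη)⁻³` at the bond), under the
standing hypotheses of `ineq1142_pointwise`:
`|D^{η*}_{U₁U₀}∂(U₁U₀)(b)| ≤ (α₀ + α₂ + 36dα₂² + 50dα₂³ + 10dα₀α₂)(Lʲη)⁻³η²`.
[cite: Balaban1985RegularSpaces, (1.142) p.100] -/
theorem ineq1142 {η : ℝ} (hη : 0 < η) {U₀ : Site d → Fin d → 𝔸ˣ} (h₀ : ∀ y κ, U₀ y κ ∈ U1 𝔸)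
    {A : Site d → Fin d → 𝔸} (h₁ : ∀ y κ, expCfg (iEta η A) y κ ∈ U1 𝔸) {L j : ℕ} {α₀ α₂ : ℝ}
    (hα₀ : 0 ≤ α₀) (hα₂ : 0 ≤ α₂) (hA : ∀ y κ, ‖A y κ‖ ≤ α₂ * ((L : ℝ) ^ j * η)⁻¹)
    (hG : ∀ (y : Site d) (κ τ : Fin d), ‖covDerivFwd η U₀ κ (fun z => A z τ) y‖ ≤ α₂ * (((L : ℝ) ^ j * η)⁻¹) ^ 2)
    (hu : ∀ y κ, ‖(expCfg (iEta η A) y κ : 𝔸) - 1‖ ≤ α₂ * ((L : ℝ) ^ j * η)⁻¹ * η)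
    (hp : ∀ (y : Site d) (κ ν : Fin d), κ ≠ ν → ‖plaqF U₀ κ ν y - 1‖ ≤ α₀ * η ^ 2 * (((L : ℝ) ^ j * η)⁻¹) ^ 2)
    (hsmall : 16 * (α₂ * ((L : ℝ) ^ j * η)⁻¹ * η) ≤ 1)
    (hd : 5 * (α₂ * ((L : ℝ) ^ j * η)⁻¹ * η) * ((d : ℝ) - 1) ≤ 4) {μ : Fin d} {x : Site d}
    (h9 : ‖covDiv η U₀ μ x‖ ≤ α₀ * (η ^ 2 * (((L : ℝ) ^ j * η)⁻¹) ^ 3))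
    (hDDA : ‖pdiv η U₀ (plaqCovDeriv η U₀ A) μ x‖ ≤ α₂ * (((L : ℝ) ^ j * η)⁻¹) ^ 3) :
    ‖covDiv η (mulCfg (expCfg (iEta η A)) U₀) μ x‖ ≤
      (α₀ + α₂ + 36 * d * α₂ ^ 2 + 50 * d * α₂ ^ 3 + 10 * d * α₀ * α₂) *
        (η ^ 2 * (((L : ℝ) ^ j * η)⁻¹) ^ 3) := by
  set r : ℝ := ((L : ℝ) ^ j * η)⁻¹
  have hr : 0 ≤ r := inv_nonneg.mpr (by positivity)
  have h := ineq1142_pointwise hη h₀ h₁ hα₀ hα₂ hA hG hu hp hsmall hd μ x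
  have h2 : η ^ 2 * ‖pdiv η U₀ (plaqCovDeriv η U₀ A) μ x‖ ≤ η ^ 2 * (α₂ * r ^ 3) :=
    mul_le_mul_of_nonneg_left hDDA (sq_nonneg η)
  refine (h.trans (add_le_add (add_le_add h9 h2) le_rfl)).trans_eq ?_
  ring

end Bond

end Literature.MathematicalPhysics.QuantumFieldTheory.Balaban1983to89.B8Ineq1141SectG

/-! ## §3. The Hermitian case: `A` self-adjoint in a C⋆-algebra (print: `A` `𝔤`-valued, `𝔤 ⊂ u(N)`, `U₀` unitary) -/

namespace Literature.MathematicalPhysics.QuantumFieldTheory.Balaban1983to89.B8Ineq1141SectG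

open B7Prop1Explicit
open B8Lemma1NonAbelian (mulCfg)
open B8Ineq132 (plaqF covDerivFwd covDiv)
open B8Eq143PlaqExpansion (pdiv)
open B8Eq146AExpansion (expCfg iEta plaqCovDeriv)
open B8Eq155JBound (expCfg_iEta_mem_U1 norm_expCfg_iEta_sub_one_le_of_141)

variable {d : ℕ} {𝔸 : Type*} [CStarAlgebra 𝔸] [Nontrivial 𝔸]

/-- **(1.141) for Hermitian `A`** (`U₁ = e^{iηA}` unitary, `|U₁ − 1| ≤ η|A|` discharged): at level `j`,
`|(U₁U₀)(∂p) − 1| ≤ (α₀ + 2α₂ + 8α₂²)η²(Lʲη)⁻² + (4α₀α₂ + (128/9)α₂³)((Lʲη)⁻¹η)·η²(Lʲη)⁻²`.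
[cite: Balaban1985RegularSpaces, (1.141) p.100] -/
theorem ineq1141_hermitian {η : ℝ} (hη : 0 < η) {U₀ : Site d → Fin d → 𝔸ˣ} (h₀ : ∀ y κ, U₀ y κ ∈ U1 𝔸)
    {A : Site d → Fin d → 𝔸} (hAh : ∀ y κ, IsSelfAdjoint (A y κ)) {L j : ℕ} {α₀ α₂ : ℝ}
    (hα₂ : 0 ≤ α₂) (hA : ∀ y κ, ‖A y κ‖ ≤ α₂ * ((L : ℝ) ^ j * η)⁻¹)
    (hG : ∀ (y : Site d) (κ τ : Fin d), ‖covDerivFwd η U₀ κ (fun z => A z τ) y‖ ≤ α₂ * (((L : ℝ) ^ j * η)⁻¹) ^ 2)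
    (hsmall : 4 * (α₂ * ((L : ℝ) ^ j * η)⁻¹ * η) ≤ 1) {μ ν : Fin d} {x : Site d}
    (hp : ‖plaqF U₀ μ ν x - 1‖ ≤ α₀ * (η ^ 2 * (((L : ℝ) ^ j * η)⁻¹) ^ 2)) :
    ‖plaqF (mulCfg (expCfg (iEta η A)) U₀) μ ν x - 1‖ ≤
      (α₀ + 2 * α₂ + 8 * α₂ ^ 2) * (η ^ 2 * (((L : ℝ) ^ j * η)⁻¹) ^ 2) +
        (4 * α₀ * α₂ + 128 / 9 * α₂ ^ 3) * (((L : ℝ) ^ j * η)⁻¹ * η) *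
          (η ^ 2 * (((L : ℝ) ^ j * η)⁻¹) ^ 2) :=
  ineq1141_printed hη h₀ (expCfg_iEta_mem_U1 η hAh) hα₂
    (norm_expCfg_iEta_sub_one_le_of_141 hη.le hAh hA) hA hG hsmall hp

/-- **(1.142) for Hermitian `A`** (`U₁ = e^{iηA}` unitary, `|U₁ − 1| ≤ η|A|` discharged): at level `j`,
`|D^{η*}_{U₁U₀}∂(U₁U₀)(b)| ≤ (α₀ + α₂ + 36dα₂² + 50dα₂³ + 10dα₀α₂)(Lʲη)⁻³η²`.
[cite: Balaban1985RegularSpaces, (1.142) p.100] -/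
theorem ineq1142_hermitian {η : ℝ} (hη : 0 < η) {U₀ : Site d → Fin d → 𝔸ˣ} (h₀ : ∀ y κ, U₀ y κ ∈ U1 𝔸)
    {A : Site d → Fin d → 𝔸} (hAh : ∀ y κ, IsSelfAdjoint (A y κ)) {L j : ℕ} {α₀ α₂ : ℝ}
    (hα₀ : 0 ≤ α₀) (hα₂ : 0 ≤ α₂) (hA : ∀ y κ, ‖A y κ‖ ≤ α₂ * ((L : ℝ) ^ j * η)⁻¹)
    (hG : ∀ (y : Site d) (κ τ : Fin d), ‖covDerivFwd η U₀ κ (fun z => A z τ) y‖ ≤ α₂ * (((L : ℝ) ^ j * η)⁻¹) ^ 2)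
    (hp : ∀ (y : Site d) (κ ν : Fin d), κ ≠ ν → ‖plaqF U₀ κ ν y - 1‖ ≤ α₀ * η ^ 2 * (((L : ℝ) ^ j * η)⁻¹) ^ 2)
    (hsmall : 16 * (α₂ * ((L : ℝ) ^ j * η)⁻¹ * η) ≤ 1)
    (hd : 5 * (α₂ * ((L : ℝ) ^ j * η)⁻¹ * η) * ((d : ℝ) - 1) ≤ 4) {μ : Fin d} {x : Site d}
    (h9 : ‖covDiv η U₀ μ x‖ ≤ α₀ * (η ^ 2 * (((L : ℝ) ^ j * η)⁻¹) ^ 3))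
    (hDDA : ‖pdiv η U₀ (plaqCovDeriv η U₀ A) μ x‖ ≤ α₂ * (((L : ℝ) ^ j * η)⁻¹) ^ 3) :
    ‖covDiv η (mulCfg (expCfg (iEta η A)) U₀) μ x‖ ≤
      (α₀ + α₂ + 36 * d * α₂ ^ 2 + 50 * d * α₂ ^ 3 + 10 * d * α₀ * α₂) *
        (η ^ 2 * (((L : ℝ) ^ j * η)⁻¹) ^ 3) :=
  ineq1142 hη h₀ (expCfg_iEta_mem_U1 η hAh) hα₀ hα₂ hA hG
    (norm_expCfg_iEta_sub_one_le_of_141 hη.le hAh hA) hp hsmall hd h9 hDDA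

#print axioms ineq1141_pointwise
#print axioms ineq1141
#print axioms ineq1141_printed
#print axioms ineq1142_pointwise
#print axioms ineq1142
#print axioms ineq1141_hermitian
#print axioms ineq1142_hermitian

end Literature.MathematicalPhysics.QuantumFieldTheory.Balaban1983to89.B8Ineq1141SectG

end
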